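import Summits.BirchSwinnertonDyer.Rank1Residual.X9.PrintCertTamagawaCertsX9S4R0
import Summits.BirchSwinnertonDyer.Rank1Residual.X9.PrintCertRecordsS4R0A
import Summits.BirchSwinnertonDyer.Rank1Residual.X9.PrintCertRecordsS4R0B
import Summits.BirchSwinnertonDyer.Rank1Residual.X9.PrintCertRecordsS4R0C
import HarnessLib

/-!
# The Tamagawa certificates PASS IN THE KERNEL — leaf X9, image `5S4`, rank `0`: display theorems, J-regime census

Group: leaf X9, image `5S4`, analytic rank `0` (slices `S4R0A`–`C`: 297 records). HONEST FRAMING (cell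
`bsd-print-x9`, D-0131 (2) print tier): theorems only; no named fact; nothing asserted about any elliptic curve
beyond what the kernel rechecks; no pair is booked and no leaf is closed (`BSDpOnClassX9`, `BSDpOnClassX10b` stay
`@[conjecture]`). For each slice: `tamWalk_<Slice>` — every record's Tamagawa row certificate
(`X9/PrintCertTamagawaCertsX9S4R0.lean`) passes `Record.tamCheck` (`X9/PrintCertTamagawa.lean`) on the record's
integral model, by `decide +kernel`; hence for ANY globally minimal `W / ℚ` with `integralModelInt W = r.intCurve`
(`W = r.curve`, `hI = r.integralModelInt_curve` for the record's own model): `tamagawaProduct_of_mem_<Slice>` (`∏_ℓ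
c_ℓ(W) = r.tamagawa`), `not_dvd_tamagawaProduct_of_mem_<Slice>` (J-VACUOUS pairs: `¬ p ∣ ∏ c_ℓ`, the `htam0` binder
of `pPartBSD_of_classX9_of_not_dvd_tamagawa_of_integralMainConjectureOnClassX9`), `exists_carrier_of_mem_<Slice>`
(SINGLE-CARRIER pairs: the literal hypothesis of the BC3 case split `HeegnerDivisibilityX9_of` of crux J, item
20392), and `exists_tamCheck_of_mem_<Slice>` (the certificate itself, for
`Record.localTamagawaNumber_eq_of_tamCheck_of_mem_bad`: `c(W/ℚ_[q]) = c_q` at every listed prime). Kernel census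
`regime_<Slice>`: group totals 297 records = J-vacuous 252 + single-carrier 44 + multi-prime 1; `jScreen_<Slice>`:
on every J-LIVE record every Heegner triple of record `(D, m, v_p(m))` has `ord_p ∏ c_ℓ ≤ v_p(m)` (0 triples; a
DATA-level necessary condition of J — `p^t ∣ [E(K):ℤy_K]` — read on the fold's Heegner indices, not a theorem about
curves).
-/

namespace Summit.BirchSwinnertonDyer.Rank1Residual.X9.PrintCert

open WeierstrassCurve Summit.BirchSwinnertonDyer.BirchSwinnertonDyer.Rank2Observatory.Tam

-- `decide +kernel` runs Tate's algorithm certificates and trial division on every record: raise the recursion depth.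
set_option maxRecDepth 100000

/-! ### Slice `S4R0A` (99 records) -/

/-- **The 99 Tamagawa row certificates of slice `S4R0A` PASS IN THE KERNEL** against `recordsS4R0A` (Tate's
algorithm certificates on each record's integral model; all local values exact; kernel product = `tamagawa`, kernel
local values = `bad`). [cite: Silverman1994, IV.9.4] [cite: Tate1975, §7] -/
theorem tamWalk_S4R0A : tamWalk recordsS4R0A tamCertsS4R0A = true := by
  decide +kernel

/-- Every record of slice `S4R0A` has a passing Tamagawa certificate (feed it to
`Record.localTamagawaNumber_eq_of_tamCheck_of_mem_bad` / `Record.dvd_conductorNorm_of_tamCheck`). [cite: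
Silverman1994, IV.9.4] -/
theorem exists_tamCheck_of_mem_S4R0A {r : Record} (hr : r ∈ recordsS4R0A) : ∃ c ∈ tamCertsS4R0A, r.tamCheck c = true :=
  exists_tamCheck_of_tamWalk tamWalk_S4R0A r hr

/-- **`∏_ℓ c_ℓ(W) = r.tamagawa` IN THE KERNEL for every record of slice `S4R0A`** and any globally minimal `W / ℚ`
with the record's integral model. [cite: Silverman1994, IV.9.4] [cite: CremonaAlgorithms1997, Table 1] -/
theorem tamagawaProduct_of_mem_S4R0A {r : Record} (hr : r ∈ recordsS4R0A) {W : WeierstrassCurve ℚ}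
    [W.IsGloballyMinimal] (hI : integralModelInt W = r.intCurve) : W.tamagawaProduct = r.tamagawa :=
  tamagawaProduct_eq_of_tamWalk tamWalk_S4R0A hr hI

/-- **J-VACUOUS records of slice `S4R0A`** (`¬ p ∣ tamagawa`, decidable on the data; 91 of 99): `¬ p ∣ ∏_ℓ c_ℓ(W)`
IN THE KERNEL (free prime `q`, `hq : q = r.p`). [cite: Silverman1994, IV.9.4] -/
theorem not_dvd_tamagawaProduct_of_mem_S4R0A {r : Record} (hr : r ∈ recordsS4R0A) (hp : ¬ r.p ∣ r.tamagawa)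
    {W : WeierstrassCurve ℚ} [W.IsGloballyMinimal] (hI : integralModelInt W = r.intCurve) {q : ℕ} (hq : q = r.p) :
    ¬ q ∣ W.tamagawaProduct :=
  not_dvd_tamagawaProduct_of_tamWalk tamWalk_S4R0A hr hp hI hq

/-- **SINGLE-CARRIER records of slice `S4R0A`** (`singleCarrier = some q₀`; 7 of 99): there is a prime `q ∣ N(W)`
with `ord_p ∏_ℓ c_ℓ(W) ≤ ord_p c(W/ℚ_[q])` IN THE KERNEL — the single-prime hypothesis of
`HeegnerDivisibilityX9_of`. [cite: Jetchev2008, Thm. 1.1] [cite: Silverman1994, IV.9.4] -/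
theorem exists_carrier_of_mem_S4R0A {r : Record} (hr : r ∈ recordsS4R0A) {q₀ : ℕ} (hs : r.singleCarrier = some q₀)
    {W : WeierstrassCurve ℚ} [W.IsElliptic] [W.IsGloballyMinimal] (hI : integralModelInt W = r.intCurve) {p : ℕ}
    (hp : p = r.p) : ∃ (q : ℕ) (_ : Fact q.Prime), q ∣ W.conductorNorm ℤ ∧
      padicValNat p W.tamagawaProduct ≤ padicValNat p ((W.baseChange ℚ_[q]).localTamagawaNumber ℤ_[q]) :=
  exists_carrier_of_tamWalk tamWalk_S4R0A hr hs hI hp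

/-- KERNEL CENSUS of slice `S4R0A` by J-regime: 91 J-vacuous records (`¬ p ∣ tamagawa`), 7 with a single carrier, 1
in the multi-prime regime (`p ∣ tamagawa`, no carrier); maximal depth `ord_p ∏ c_ℓ` = 2. [folklore] -/
theorem regime_S4R0A :
    (recordsS4R0A.filter fun r => !decide (r.p ∣ r.tamagawa)).length = 91 ∧
    (recordsS4R0A.filter fun r => r.singleCarrier.isSome).length = 7 ∧
    (recordsS4R0A.filter fun r => decide (r.p ∣ r.tamagawa) && r.singleCarrier.isNone).length = 1 ∧
    (recordsS4R0A.map fun r => padicValNat r.p r.tamagawa).foldr max 0 = 2 := by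
  decide +kernel

/-- The MULTI-PRIME records of slice `S4R0A` BY LABEL (kernel): exactly the pairs on which the second stub
`stub_multiPrime` of crux J's BC3 skeleton is load-bearing (if of analytic rank `1`). [folklore] -/
theorem multiPrime_labels_S4R0A :
    ((recordsS4R0A.filter fun r => decide (r.p ∣ r.tamagawa) && r.singleCarrier.isNone).map (·.label)) =
      ["56316n1"] := by
  decide +kernel

/-- J-SCREEN of slice `S4R0A` (data level, 0 Heegner triples on J-live records): on every record with `p ∣
tamagawa`, every Heegner triple of record `(D, m, v)` has `ord_p tamagawa ≤ v` (`= v_p` of the fold's Heegner index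
`m`; necessary for J since `y_K = P_1`). [folklore] -/
theorem jScreen_S4R0A : ∀ r ∈ recordsS4R0A, r.p ∣ r.tamagawa →
    ∀ h ∈ r.heegner, padicValNat r.p r.tamagawa ≤ h.2.2 := by
  decide +kernel

/-! ### Slice `S4R0B` (99 records) -/

/-- **The 99 Tamagawa row certificates of slice `S4R0B` PASS IN THE KERNEL** against `recordsS4R0B` (Tate's
algorithm certificates on each record's integral model; all local values exact; kernel product = `tamagawa`, kernel
local values = `bad`). [cite: Silverman1994, IV.9.4] [cite: Tate1975, §7] -/
theorem tamWalk_S4R0B : tamWalk recordsS4R0B tamCertsS4R0B = true := by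
  decide +kernel

/-- Every record of slice `S4R0B` has a passing Tamagawa certificate (feed it to
`Record.localTamagawaNumber_eq_of_tamCheck_of_mem_bad` / `Record.dvd_conductorNorm_of_tamCheck`). [cite:
Silverman1994, IV.9.4] -/
theorem exists_tamCheck_of_mem_S4R0B {r : Record} (hr : r ∈ recordsS4R0B) : ∃ c ∈ tamCertsS4R0B, r.tamCheck c = true :=
  exists_tamCheck_of_tamWalk tamWalk_S4R0B r hr

/-- **`∏_ℓ c_ℓ(W) = r.tamagawa` IN THE KERNEL for every record of slice `S4R0B`** and any globally minimal `W / ℚ`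
with the record's integral model. [cite: Silverman1994, IV.9.4] [cite: CremonaAlgorithms1997, Table 1] -/
theorem tamagawaProduct_of_mem_S4R0B {r : Record} (hr : r ∈ recordsS4R0B) {W : WeierstrassCurve ℚ}
    [W.IsGloballyMinimal] (hI : integralModelInt W = r.intCurve) : W.tamagawaProduct = r.tamagawa :=
  tamagawaProduct_eq_of_tamWalk tamWalk_S4R0B hr hI

/-- **J-VACUOUS records of slice `S4R0B`** (`¬ p ∣ tamagawa`, decidable on the data; 80 of 99): `¬ p ∣ ∏_ℓ c_ℓ(W)`
IN THE KERNEL (free prime `q`, `hq : q = r.p`). [cite: Silverman1994, IV.9.4] -/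
theorem not_dvd_tamagawaProduct_of_mem_S4R0B {r : Record} (hr : r ∈ recordsS4R0B) (hp : ¬ r.p ∣ r.tamagawa)
    {W : WeierstrassCurve ℚ} [W.IsGloballyMinimal] (hI : integralModelInt W = r.intCurve) {q : ℕ} (hq : q = r.p) :
    ¬ q ∣ W.tamagawaProduct :=
  not_dvd_tamagawaProduct_of_tamWalk tamWalk_S4R0B hr hp hI hq

/-- **SINGLE-CARRIER records of slice `S4R0B`** (`singleCarrier = some q₀`; 19 of 99): there is a prime `q ∣ N(W)`
with `ord_p ∏_ℓ c_ℓ(W) ≤ ord_p c(W/ℚ_[q])` IN THE KERNEL — the single-prime hypothesis of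
`HeegnerDivisibilityX9_of`. [cite: Jetchev2008, Thm. 1.1] [cite: Silverman1994, IV.9.4] -/
theorem exists_carrier_of_mem_S4R0B {r : Record} (hr : r ∈ recordsS4R0B) {q₀ : ℕ} (hs : r.singleCarrier = some q₀)
    {W : WeierstrassCurve ℚ} [W.IsElliptic] [W.IsGloballyMinimal] (hI : integralModelInt W = r.intCurve) {p : ℕ}
    (hp : p = r.p) : ∃ (q : ℕ) (_ : Fact q.Prime), q ∣ W.conductorNorm ℤ ∧
      padicValNat p W.tamagawaProduct ≤ padicValNat p ((W.baseChange ℚ_[q]).localTamagawaNumber ℤ_[q]) :=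
  exists_carrier_of_tamWalk tamWalk_S4R0B hr hs hI hp

/-- KERNEL CENSUS of slice `S4R0B` by J-regime: 80 J-vacuous records (`¬ p ∣ tamagawa`), 19 with a single carrier, 0
in the multi-prime regime (`p ∣ tamagawa`, no carrier); maximal depth `ord_p ∏ c_ℓ` = 1. [folklore] -/
theorem regime_S4R0B :
    (recordsS4R0B.filter fun r => !decide (r.p ∣ r.tamagawa)).length = 80 ∧
    (recordsS4R0B.filter fun r => r.singleCarrier.isSome).length = 19 ∧
    (recordsS4R0B.filter fun r => decide (r.p ∣ r.tamagawa) && r.singleCarrier.isNone).length = 0 ∧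
    (recordsS4R0B.map fun r => padicValNat r.p r.tamagawa).foldr max 0 = 1 := by
  decide +kernel

/-- J-SCREEN of slice `S4R0B` (data level, 0 Heegner triples on J-live records): on every record with `p ∣
tamagawa`, every Heegner triple of record `(D, m, v)` has `ord_p tamagawa ≤ v` (`= v_p` of the fold's Heegner index
`m`; necessary for J since `y_K = P_1`). [folklore] -/
theorem jScreen_S4R0B : ∀ r ∈ recordsS4R0B, r.p ∣ r.tamagawa →
    ∀ h ∈ r.heegner, padicValNat r.p r.tamagawa ≤ h.2.2 := by
  decide +kernel

/-! ### Slice `S4R0C` (99 records) -/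

/-- **The 99 Tamagawa row certificates of slice `S4R0C` PASS IN THE KERNEL** against `recordsS4R0C` (Tate's
algorithm certificates on each record's integral model; all local values exact; kernel product = `tamagawa`, kernel
local values = `bad`). [cite: Silverman1994, IV.9.4] [cite: Tate1975, §7] -/
theorem tamWalk_S4R0C : tamWalk recordsS4R0C tamCertsS4R0C = true := by
  decide +kernel

/-- Every record of slice `S4R0C` has a passing Tamagawa certificate (feed it to
`Record.localTamagawaNumber_eq_of_tamCheck_of_mem_bad` / `Record.dvd_conductorNorm_of_tamCheck`). [cite:
Silverman1994, IV.9.4] -/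
theorem exists_tamCheck_of_mem_S4R0C {r : Record} (hr : r ∈ recordsS4R0C) : ∃ c ∈ tamCertsS4R0C, r.tamCheck c = true :=
  exists_tamCheck_of_tamWalk tamWalk_S4R0C r hr

/-- **`∏_ℓ c_ℓ(W) = r.tamagawa` IN THE KERNEL for every record of slice `S4R0C`** and any globally minimal `W / ℚ`
with the record's integral model. [cite: Silverman1994, IV.9.4] [cite: CremonaAlgorithms1997, Table 1] -/
theorem tamagawaProduct_of_mem_S4R0C {r : Record} (hr : r ∈ recordsS4R0C) {W : WeierstrassCurve ℚ}
    [W.IsGloballyMinimal] (hI : integralModelInt W = r.intCurve) : W.tamagawaProduct = r.tamagawa :=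
  tamagawaProduct_eq_of_tamWalk tamWalk_S4R0C hr hI

/-- **J-VACUOUS records of slice `S4R0C`** (`¬ p ∣ tamagawa`, decidable on the data; 81 of 99): `¬ p ∣ ∏_ℓ c_ℓ(W)`
IN THE KERNEL (free prime `q`, `hq : q = r.p`). [cite: Silverman1994, IV.9.4] -/
theorem not_dvd_tamagawaProduct_of_mem_S4R0C {r : Record} (hr : r ∈ recordsS4R0C) (hp : ¬ r.p ∣ r.tamagawa)
    {W : WeierstrassCurve ℚ} [W.IsGloballyMinimal] (hI : integralModelInt W = r.intCurve) {q : ℕ} (hq : q = r.p) :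
    ¬ q ∣ W.tamagawaProduct :=
  not_dvd_tamagawaProduct_of_tamWalk tamWalk_S4R0C hr hp hI hq

/-- **SINGLE-CARRIER records of slice `S4R0C`** (`singleCarrier = some q₀`; 18 of 99): there is a prime `q ∣ N(W)`
with `ord_p ∏_ℓ c_ℓ(W) ≤ ord_p c(W/ℚ_[q])` IN THE KERNEL — the single-prime hypothesis of
`HeegnerDivisibilityX9_of`. [cite: Jetchev2008, Thm. 1.1] [cite: Silverman1994, IV.9.4] -/
theorem exists_carrier_of_mem_S4R0C {r : Record} (hr : r ∈ recordsS4R0C) {q₀ : ℕ} (hs : r.singleCarrier = some q₀)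
    {W : WeierstrassCurve ℚ} [W.IsElliptic] [W.IsGloballyMinimal] (hI : integralModelInt W = r.intCurve) {p : ℕ}
    (hp : p = r.p) : ∃ (q : ℕ) (_ : Fact q.Prime), q ∣ W.conductorNorm ℤ ∧
      padicValNat p W.tamagawaProduct ≤ padicValNat p ((W.baseChange ℚ_[q]).localTamagawaNumber ℤ_[q]) :=
  exists_carrier_of_tamWalk tamWalk_S4R0C hr hs hI hp

/-- KERNEL CENSUS of slice `S4R0C` by J-regime: 81 J-vacuous records (`¬ p ∣ tamagawa`), 18 with a single carrier, 0
in the multi-prime regime (`p ∣ tamagawa`, no carrier); maximal depth `ord_p ∏ c_ℓ` = 1. [folklore] -/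
theorem regime_S4R0C :
    (recordsS4R0C.filter fun r => !decide (r.p ∣ r.tamagawa)).length = 81 ∧
    (recordsS4R0C.filter fun r => r.singleCarrier.isSome).length = 18 ∧
    (recordsS4R0C.filter fun r => decide (r.p ∣ r.tamagawa) && r.singleCarrier.isNone).length = 0 ∧
    (recordsS4R0C.map fun r => padicValNat r.p r.tamagawa).foldr max 0 = 1 := by
  decide +kernel

/-- J-SCREEN of slice `S4R0C` (data level, 0 Heegner triples on J-live records): on every record with `p ∣
tamagawa`, every Heegner triple of record `(D, m, v)` has `ord_p tamagawa ≤ v` (`= v_p` of the fold's Heegner index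
`m`; necessary for J since `y_K = P_1`). [folklore] -/
theorem jScreen_S4R0C : ∀ r ∈ recordsS4R0C, r.p ∣ r.tamagawa →
    ∀ h ∈ r.heegner, padicValNat r.p r.tamagawa ≤ h.2.2 := by
  decide +kernel

end Summit.BirchSwinnertonDyer.Rank1Residual.X9.PrintCert
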